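import Summits.Ventures.HSemireg.WedgeHankelRecurrenceGaussChebyshevClebschGordan

/-!
# Venture HSemireg — **DIRICHLET-KERNEL SUMS IN EVERY COMMUTATIVE RING: `1 + Σ_{k=1}^{n} C_k = S_n + S_{n−1}`, `Σ_{k=0}^{n} C_{2k+1} = S_{2n+1}`, `1 + Σ_{k=1}^{n} C_{2k} = S_{2n}`, and the Chebyshev form
# `1 + 2Σ_{k=1}^{n} T_k = U_n + U_{n−1}`** (at `x = 2cos θ`: the Dirichlet kernel `1 + 2Σ cos kθ = sin((n+½)θ)∕sin(θ∕2)` and Lagrange's identities `Σ cos((2k+1)θ) = sin(2(n+1)θ)∕(2 sin θ)`; telescoping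
# `C_k = S_k − S_{k−2}`, `2T_k = U_k − U_{k−2}`; the parity-split `T ∕ U` forms `U_{2n+1} = 2Σ T_{2k+1}`, `U_{2n} = 1 + 2Σ T_{2k+2}` are ALREADY in the tree — `Literature.Algebra.Polynomial.ChebyshevExplicitForms` — and
# are cited, not restated)

HONEST FRAMING. Part of the Lean index of the computation cell `pub-hsemireg` (seat p10 gen 49, Sunday typer «UNIFORM-IN-n»).  Polynomial algebra over a commutative ring (Mathlib
`Polynomial.Chebyshev.T ∕ U ∕ C ∕ S`, `Finset.sum`); no variety, no cohomology theory, no sheaf, no Ext group and no semiregularity map is constructed here; nothing here says that HC / HC_CM / HC_AV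
holds; no Literature fact (unproved `Prop`) is declared or used.  Custodian versions as in `WedgeHankelSiegelIdeal` (1/3).
SOURCES (cited).  A. Zygmund, *Trigonometric Series* I (Cambridge 1959), Ch. II §5 (Dirichlet's kernel `D_n(θ) = ½ + Σ_{k≤n} cos kθ = sin((n+½)θ)∕(2 sin(θ∕2))`); J. C. Mason, D. C. Handscomb,
*Chebyshev Polynomials* (2003), §2.4.3 (sums of `T_k` in terms of `U_n`); I. S. Gradshteyn, I. M. Ryzhik, *Table*, 1.342 (Lagrange's trigonometric identities).
PROOF TYPED HERE.  Induction on `n` with the telescoping steps `C_{n+2} = S_{n+2} − S_n` (N535 `chebyshevC_add_two_eq_S_sub_S`) and `2T_{n+2} = U_{n+2} − U_n` (Mathlib `two_mul_T_eq_U_sub_U`),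
`Finset.sum_range_succ`; bases `S_{−1} = 0 = U_{−1}`, `S_0 = U_0 = 1`, `C_1 = S_1 = X`, `2T_1 = U_1 = 2X`.
DEDUP DISCLOSURE (`rg -n '∑ .*(Chebyshev\.)?(C|T) R|range .*T R \(2' Summits/Ventures/HSemireg Literature`, 2026-09-04): the PARITY-SPLIT `T ∕ U` sums ARE in the tree —
`Literature.Algebra.Polynomial.ChebyshevExplicitForms.U_two_mul_add_one_eq_two_mul_sum` (`U_{2k+1} = 2Σ_{j≤k} T_{2j+1}`), `U_two_mul_eq_one_add_two_mul_sum` (`U_{2k} = 1 + 2Σ_{j<k} T_{2j+2}`) and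
`X_mul_U_two_mul_add_one` (Rivlin 1974, Ex. 1.2) — CITED, not restated and not imported (that module does `import Mathlib`); the `C ∕ S` statements below are their images under `X ↦ X∕2` in the Vieta
normalisation and the unsplit `T`-sum `1 + 2Σ_{k≤n} T_k = U_n + U_{n−1}` is not typed; `Literature.Algebra.Polynomial.ChebyshevPowerExpansion` has the binomial expansions `X^n = 2^{1−n}Σ C(n,k) T_{n−2k}` (a
different sum); the half-angle polynomials `S_n ± S_{n−1}` are N501 ∕ N503; 0 hits for the 4 names below.

WHAT IS IN THE TREE.  `Literature.Algebra.Polynomial.ChebyshevExplicitForms.U_two_mul_add_one_eq_two_mul_sum ∕ U_two_mul_eq_one_add_two_mul_sum` (cited); N535 `chebyshevC_add_two_eq_S_sub_S`; Mathlib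
`two_mul_T_eq_U_sub_U`, `S_zero ∕ S_one ∕ S_neg_one`, `U_zero ∕ U_one ∕ U_neg_one`, `C_one`, `T_one`, `Finset.sum_range_succ`.
THIS FILE (namespace `Summit.Ventures.HSemireg.Wedge.HankelOuter` continued; CHAINED on N537; 0 definitions):
* §1303 **`one_add_sum_chebyshevC`** (`1 + Σ_{k<n} C_{k+1} = S_n + S_{n−1}`), **`sum_chebyshevC_odd`** (`Σ_{k≤n} C_{2k+1} = S_{2n+1}`), **`one_add_sum_chebyshevC_even`** (`1 + Σ_{k<n} C_{2k+2} = S_{2n}`),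
  **`one_add_two_mul_sum_chebyshevT`** (`1 + 2Σ_{k<n} T_{k+1} = U_n + U_{n−1}`).
CAVEATS.  Sums written over `Finset.range` with shifted indices; all `n ∈ ℕ`.  Nothing Ext-side.  New names only.
-/

open Module Polynomial
open scoped Matrix Polynomial

namespace Summit.Ventures.HSemireg.Wedge.HankelOuter

/-! ## §1303. Dirichlet-kernel sums -/

/-! ### `C` ∕ `S` -/

/-- **`1 + Σ_{k=1}^{n} C_k = S_n + S_{n−1}`** in every commutative ring (Dirichlet kernel: at `x = 2cos θ` both sides are `sin((n+½)θ)∕sin(θ∕2)`). [Zygmund II §5; this file, §1303] -/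
theorem one_add_sum_chebyshevC (R : Type*) [CommRing R] (n : ℕ) :
    1 + ∑ k ∈ Finset.range n, Polynomial.Chebyshev.C R ((k : ℤ) + 1) = Polynomial.Chebyshev.S R (n : ℤ) + Polynomial.Chebyshev.S R ((n : ℤ) - 1) := by
  induction n with
  | zero => simp [Polynomial.Chebyshev.S_neg_one]
  | succ m ih =>
    rw [Finset.sum_range_succ, ← add_assoc, ih]
    have h := chebyshevC_add_two_eq_S_sub_S R ((m : ℤ) - 1)
    rw [show (m : ℤ) - 1 + 2 = (m : ℤ) + 1 by ring] at h
    rw [h]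
    push_cast
    ring_nf

/-- **`Σ_{k=0}^{n} C_{2k+1} = S_{2n+1}`** in every commutative ring (Lagrange: `Σ cos((2k+1)θ) = sin(2(n+1)θ)∕(2 sin θ)`). [Gradshteyn–Ryzhik 1.342; this file, §1303] -/
theorem sum_chebyshevC_odd (R : Type*) [CommRing R] (n : ℕ) :
    ∑ k ∈ Finset.range (n + 1), Polynomial.Chebyshev.C R (2 * (k : ℤ) + 1) = Polynomial.Chebyshev.S R (2 * (n : ℤ) + 1) := by
  induction n with
  | zero => simp
  | succ m ih =>
    rw [Finset.sum_range_succ, ih]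
    have h := chebyshevC_add_two_eq_S_sub_S R (2 * (m : ℤ) + 1)
    push_cast
    rw [show 2 * ((m : ℤ) + 1) + 1 = 2 * (m : ℤ) + 1 + 2 by ring, h]
    ring

/-- **`1 + Σ_{k=1}^{n} C_{2k} = S_{2n}`** in every commutative ring (Lagrange: `1 + 2Σ cos(2kθ) = sin((2n+1)θ)∕sin θ`). [Gradshteyn–Ryzhik 1.342; this file, §1303] -/
theorem one_add_sum_chebyshevC_even (R : Type*) [CommRing R] (n : ℕ) :
    1 + ∑ k ∈ Finset.range n, Polynomial.Chebyshev.C R (2 * (k : ℤ) + 2) = Polynomial.Chebyshev.S R (2 * (n : ℤ)) := by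
  induction n with
  | zero => simp
  | succ m ih =>
    rw [Finset.sum_range_succ, ← add_assoc, ih]
    have h := chebyshevC_add_two_eq_S_sub_S R (2 * (m : ℤ))
    push_cast
    rw [h]
    ring_nf

/-! ### `T` ∕ `U` -/

/-- **`1 + 2Σ_{k=1}^{n} T_k = U_n + U_{n−1}`** in every commutative ring (Dirichlet kernel in Chebyshev form; the parity-split forms `U_{2k+1} = 2Σ T_{2j+1}`, `U_{2k} = 1 + 2Σ T_{2j+2}` are
`Literature.Algebra.Polynomial.ChebyshevExplicitForms.U_two_mul_add_one_eq_two_mul_sum ∕ U_two_mul_eq_one_add_two_mul_sum`). [Mason–Handscomb 2003, §2.4.3; Zygmund II §5; this file, §1303] -/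
theorem one_add_two_mul_sum_chebyshevT (R : Type*) [CommRing R] (n : ℕ) :
    1 + 2 * ∑ k ∈ Finset.range n, Polynomial.Chebyshev.T R ((k : ℤ) + 1) = Polynomial.Chebyshev.U R (n : ℤ) + Polynomial.Chebyshev.U R ((n : ℤ) - 1) := by
  induction n with
  | zero => simp [Polynomial.Chebyshev.U_neg_one]
  | succ m ih =>
    rw [Finset.sum_range_succ, mul_add, ← add_assoc, ih]
    have h := Polynomial.Chebyshev.two_mul_T_eq_U_sub_U R ((m : ℤ) - 1)
    rw [show (m : ℤ) - 1 + 2 = (m : ℤ) + 1 by ring] at h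
    rw [h]
    push_cast
    ring_nf

end Summit.Ventures.HSemireg.Wedge.HankelOuter
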